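import Literature.NumberTheory.Transcendental.FormIntegration
import Mathlib.Analysis.Calculus.ContDiff.CPolynomial
import Mathlib.Analysis.Analytic.CPolynomial
import Mathlib.MeasureTheory.Function.Jacobian
import HarnessLib

/-!
# Chart pull-backs of forms, their smoothness, and the integral of a chart bump form

Topic: integration of differential forms on closed oriented manifolds (Lee (2013), Ch. 14–16),
the chart-level machinery for `Literature.Geometry.Kaehler.deRhamCohomology.integral_bijective`
(`Literature/NumberTheory/Transcendental/FormIntegration.lean`, whose `MForm.inChart`,
`IsSmoothForm`, `mextDeriv`, `chartSign`, `MForm.integral` this file analyses). Everything is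
proved; the setting for the smoothness statements is a boundaryless `C^∞` manifold
(`[I.Boundaryless]`, so `range I = univ` and chart targets are open).

## Main definitions

* `Literature.NumberTheory.Transcendental.alternatizationCLM`: alternatization of continuous multilinear maps as a continuous
  linear map (Mathlib bundles it only as `→+`); used to transfer `C^n`-smoothness from
  continuous-multilinear-valued maps to continuous-alternating-valued ones.
* `Literature.MForm.ofChart p η`: the extension by zero to `M` of the pull-back of a form `η` on the
  model space along the extended chart at `p` (Lee (2013), proof of Thm. 17.30).
* `Literature.orientationForm o x`: the representative `(o x).someVector` of the orientation at `x`,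
  read on the model space.
* `Literature.MForm.chartDensity p α`: the coefficient of the chart representative of a top form on the
  reference frame, `α̂_p = (chartDensity p α) • dx¹ ∧ ⋯ ∧ dxⁿ`, extended by zero.

## Main statements (all proved)

* `ContDiffWithinAt.continuousAlternatingMapCompContinuousLinearMap`: pull-backs of `C^n`
  families of continuous alternating maps along `C^n` families of linear maps are `C^n`.
* `Literature.Geometry.Kaehler.MForm.inChart_extChartAt_eq_comp`: the transition formula between chart
  representatives (cocycle `tangentCoordChange_comp`); `Literature.Geometry.Kaehler.IsSmoothForm.contDiffOn_inChart`:
  representatives of smooth forms are smooth on the whole chart target.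
* `Literature.NumberTheory.Transcendental.isSmoothForm_ofChart`, `Literature.NumberTheory.Transcendental.mextDeriv_ofChart`: `ofChart p η` is smooth and
  `d (ofChart p η) = ofChart p (dη)` for `η` smooth with compact support in the chart target
  (Lee (2013), Prop. 14.26, via Mathlib's `extDeriv_pullback`).
* `Literature.NumberTheory.Transcendental.chartSign_extChartAt_eq_sign_det_mul`: chart signs transform by the sign of the Jacobian
  determinant of the transition map.
* `Literature.Geometry.Kaehler.MForm.integral_ofChart_smul`: `∫_M ofChart p (g • D) = ε ∫ g ∂(modelBasis E n).addHaar`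
  when the chart sign is `ε` on the support of `g` (change of variables
  `integral_image_eq_integral_abs_det_fderiv_smul` chart by chart, and `∑ᵢ ρᵢ = 1`;
  Lee (2013), Prop. 16.4–16.5).
* `Literature.Geometry.Kaehler.MForm.eq_ofChart_chartDensity_smul`, `Literature.Geometry.Kaehler.MForm.integral_eq_chartDensity`: a top form
  supported in a chart is `ofChart p (chartDensity p α • D)` and integrates to
  `ε ∫ chartDensity p α`.

## Mathlib status

Mathlib (pinned v4.32.0) has the calculus of `ContinuousAlternatingMap.compContinuousLinearMap`
only at the `HasFDerivAt` level (`HasFDerivWithinAt.continuousAlternatingMapCompContinuousLinearMap`)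
and the analyticity of the continuous-multilinear pull-back
(`ContinuousMultilinearMap.cpolynomialAt_uncurry_compContinuousLinearMap`); the `C^n` statement
for alternating maps is derived here through `alternatizationCLM`. The tangent coordinate
changes (`tangentCoordChange`, `TangentBundle.symmL_trivializationAt`), smooth partitions of
unity and the change of variables formula are Mathlib's. The two dot-notation lemmas
`ContDiffWithinAt/ContDiffAt.continuousAlternatingMapCompContinuousLinearMap` and
`ContDiffAt.continuousAlternatingMap_apply_const` are declared in the `Literature` namespace.

## Design notes

* `MForm.ofChart p η x` is spelled with `tangentCoordChange I x p x` (the derivative of the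
  extended chart at `x` read in the chart at `x`, `TangentBundle.continuousLinearMapAt_trivializationAt`)
  rather than `mfderiv`, and the value is built in `E [⋀^Fin k]→L[ℝ] ℝ` and transported along
  the definitional equality `TangentSpace I x = E`.
* Statements about `chartSign` are routed through `orientationForm o x : E [⋀^Fin n]→ₗ[ℝ] ℝ`
  so that all rewriting happens on the model space.

## References

* J. M. Lee, *Introduction to Smooth Manifolds*, 2nd ed., GTM 218, Springer (2013):
  Prop. 14.9 (p. 389), Lemma 14.16 (p. 395), Prop. 14.26 (p. 400), Prop. 15.6 (p. 415),
  Prop. 16.4–16.6 (pp. 438–440), Thm. 17.30 (p. 485).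
* F. W. Warner, *Foundations of Differentiable Manifolds and Lie Groups* (1983), 2.18, 4.8.
-/

noncomputable section

open scoped Manifold ContDiff Topology
open Bundle Set Module MeasureTheory Function Filter

namespace Literature.NumberTheory.Transcendental

/-! ### Smoothness of pull-backs of continuous alternating maps -/

section AltSmooth

variable {𝕜 : Type*} [NontriviallyNormedField 𝕜]
  {E F G X : Type*} [NormedAddCommGroup E] [NormedSpace 𝕜 E] [NormedAddCommGroup F]
  [NormedSpace 𝕜 F] [NormedAddCommGroup G] [NormedSpace 𝕜 G] [NormedAddCommGroup X]
  [NormedSpace 𝕜 X] {ι : Type*} [Fintype ι] [DecidableEq ι]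

variable (𝕜 E F ι) in
/-- Alternatization of continuous multilinear maps as a *continuous linear* map (Mathlib's
`ContinuousMultilinearMap.alternatization` is bundled only as an additive homomorphism); the
operator norm bound is `(card ι)!`. [folklore] -/
def alternatizationCLM :
    ContinuousMultilinearMap 𝕜 (fun _ : ι ↦ E) F →L[𝕜] E [⋀^ι]→L[𝕜] F :=
  LinearMap.mkContinuous
    { toFun := ContinuousMultilinearMap.alternatization
      map_add' := fun f g ↦ map_add _ f g
      map_smul' := fun c f ↦ by
        ext v
        simp [ContinuousMultilinearMap.alternatization_apply_apply, Finset.smul_sum, smul_comm c] }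
    (Fintype.card (Equiv.Perm ι)) fun f ↦ by
      change ‖ContinuousMultilinearMap.alternatization f‖ ≤ _
      rw [← ContinuousAlternatingMap.norm_toContinuousMultilinearMap]
      change ‖∑ σ : Equiv.Perm ι, Equiv.Perm.sign σ • f.domDomCongr σ‖ ≤ _
      refine (norm_sum_le _ _).trans ?_
      have : ∀ σ : Equiv.Perm ι, ‖Equiv.Perm.sign σ • f.domDomCongr σ‖ = ‖f‖ := by
        intro σ
        rcases Int.units_eq_one_or (Equiv.Perm.sign σ) with h | h
        · rw [h, one_smul, ContinuousMultilinearMap.norm_domDomCongr]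
        · rw [h, Units.neg_smul, one_smul, norm_neg, ContinuousMultilinearMap.norm_domDomCongr]
      simp only [this, Finset.sum_const, Finset.card_univ, nsmul_eq_mul, le_refl]

/-- `alternatizationCLM` is Mathlib's `ContinuousMultilinearMap.alternatization`. [folklore] -/
theorem alternatizationCLM_apply (f : ContinuousMultilinearMap 𝕜 (fun _ : ι ↦ E) F) :
    alternatizationCLM 𝕜 E F ι f = ContinuousMultilinearMap.alternatization f := rfl

/-- Alternatizing an alternating map multiplies it by `(card ι)!`. [folklore] -/
theorem alternatizationCLM_toContinuousMultilinearMap (f : E [⋀^ι]→L[𝕜] F) :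
    alternatizationCLM 𝕜 E F ι f.toContinuousMultilinearMap =
      ((Fintype.card ι).factorial : 𝕜) • f := by
  apply ContinuousAlternatingMap.toAlternatingMap_injective
  rw [alternatizationCLM_apply, ContinuousMultilinearMap.alternatization_apply_toAlternatingMap,
    ContinuousAlternatingMap.toAlternatingMap_smul, Nat.cast_smul_eq_nsmul]
  exact AlternatingMap.coe_alternatization f.toAlternatingMap

variable [CharZero 𝕜]

omit [DecidableEq ι] in
/-- A map with values in continuous alternating maps is `C^n` within a set at a point as soon as
its composition with the embedding into continuous multilinear maps is (over a field of
characteristic zero: divide the alternatization by `(card ι)!`). [folklore] -/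
theorem contDiffWithinAt_of_toContinuousMultilinearMap {f : X → E [⋀^ι]→L[𝕜] F} {s : Set X}
    {x : X} {n : WithTop ℕ∞}
    (hf : ContDiffWithinAt 𝕜 n (fun y ↦ (f y).toContinuousMultilinearMap) s x) :
    ContDiffWithinAt 𝕜 n f s x := by
  classical
  have hk : ((Fintype.card ι).factorial : 𝕜) ≠ 0 := Nat.cast_ne_zero.2 (Nat.factorial_ne_zero _)
  have : f = fun y ↦ ((Fintype.card ι).factorial : 𝕜)⁻¹ •
      alternatizationCLM 𝕜 E F ι (f y).toContinuousMultilinearMap := by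
    funext y
    rw [alternatizationCLM_toContinuousMultilinearMap, smul_smul, inv_mul_cancel₀ hk, one_smul]
  rw [this]
  exact ((alternatizationCLM 𝕜 E F ι).contDiff.comp_contDiffWithinAt hf).const_smul _

omit [DecidableEq ι] in
/-- The pull-back `(f y).compContinuousLinearMap (g y)` of a `C^n` family of continuous
alternating maps along a `C^n` family of continuous linear maps is `C^n` (Mathlib has the
`HasFDerivAt` version, `HasFDerivWithinAt.continuousAlternatingMapCompContinuousLinearMap`; the
`C^n` version follows from the analyticity of the continuous-multilinear pull-back,
`ContinuousMultilinearMap.cpolynomialAt_uncurry_compContinuousLinearMap`). [folklore] -/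
theorem ContDiffWithinAt.continuousAlternatingMapCompContinuousLinearMap
    {f : X → F [⋀^ι]→L[𝕜] G} {g : X → E →L[𝕜] F} {s : Set X} {x : X} {n : WithTop ℕ∞}
    (hf : ContDiffWithinAt 𝕜 n f s x) (hg : ContDiffWithinAt 𝕜 n g s x) :
    ContDiffWithinAt 𝕜 n (fun y ↦ (f y).compContinuousLinearMap (g y)) s x := by
  apply contDiffWithinAt_of_toContinuousMultilinearMap
  have hP : ContDiff 𝕜 n (fun p : (ι → (E →L[𝕜] F)) ×
      ContinuousMultilinearMap 𝕜 (fun _ : ι ↦ F) G ↦ p.2.compContinuousLinearMap p.1) :=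
    contDiff_iff_contDiffAt.2 fun p ↦
      (ContinuousMultilinearMap.cpolynomialAt_uncurry_compContinuousLinearMap).contDiffAt
  have h2 : ContDiffWithinAt 𝕜 n
      (fun y ↦ ((fun _ : ι ↦ g y), (f y).toContinuousMultilinearMap)) s x :=
    (contDiffWithinAt_pi.2 fun _ ↦ hg).prodMk
      ((ContinuousAlternatingMap.toContinuousMultilinearMapCLM 𝕜
        (E := F) (F := G) (ι := ι) (𝕜 := 𝕜)).contDiff.comp_contDiffWithinAt hf)
  exact hP.comp_contDiffWithinAt h2

omit [DecidableEq ι] in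
/-- `ContDiffAt` version of
`ContDiffWithinAt.continuousAlternatingMapCompContinuousLinearMap`. [folklore] -/
theorem ContDiffAt.continuousAlternatingMapCompContinuousLinearMap
    {f : X → F [⋀^ι]→L[𝕜] G} {g : X → E →L[𝕜] F} {x : X} {n : WithTop ℕ∞}
    (hf : ContDiffAt 𝕜 n f x) (hg : ContDiffAt 𝕜 n g x) :
    ContDiffAt 𝕜 n (fun y ↦ (f y).compContinuousLinearMap (g y)) x :=
  (ContDiffWithinAt.continuousAlternatingMapCompContinuousLinearMap (s := univ)
    hf.contDiffWithinAt hg.contDiffWithinAt).contDiffAt Filter.univ_mem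

omit [DecidableEq ι] [CharZero 𝕜] in
/-- Evaluation at a fixed family of vectors preserves `C^n`-smoothness of a family of continuous
alternating maps (evaluation is a continuous linear map). [folklore] -/
theorem ContDiffAt.continuousAlternatingMap_apply_const {f : X → E [⋀^ι]→L[𝕜] F} {x : X}
    {n : WithTop ℕ∞} (hf : ContDiffAt 𝕜 n f x) (v : ι → E) :
    ContDiffAt 𝕜 n (fun y ↦ f y v) x := by
  have : (fun y ↦ f y v) = ((ContinuousMultilinearMap.apply 𝕜 (fun _ : ι ↦ E) F v).comp
      (ContinuousAlternatingMap.toContinuousMultilinearMapCLM 𝕜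
        (E := E) (F := F) (ι := ι) (𝕜 := 𝕜))) ∘ f := rfl
  rw [this]
  exact (ContinuousLinearMap.contDiff _).comp_contDiffAt x hf

end AltSmooth

/-! ### Top-degree alternating forms and determinants -/

section TopAlgebra

variable {E : Type*} [NormedAddCommGroup E] [NormedSpace ℝ E] {ι : Type*} [Fintype ι]
  [DecidableEq ι]

/-- A top-degree alternating form transforms under an endomorphism `L` by `det L`:
`w (L v₁, …, L vₙ) = det L · w (v₁, …, vₙ)`. Lee (2013), Prop. 14.9 / Lemma 14.16.
[cite: LeeSmoothManifolds2013, Prop. 14.9] -/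
theorem AlternatingMap.apply_linearMap_comp_eq_det_mul (e : Basis ι ℝ E) (w : E [⋀^ι]→ₗ[ℝ] ℝ)
    (L : E →ₗ[ℝ] E) (v : ι → E) : w (fun i ↦ L (v i)) = LinearMap.det L * w v := by
  rw [AlternatingMap.eq_smul_basis_det e w]
  simp only [AlternatingMap.smul_apply, smul_eq_mul]
  rw [show (fun i ↦ L (v i)) = L ∘ v from rfl, Basis.det_comp]
  ring

/-- Continuous version of `AlternatingMap.apply_linearMap_comp_eq_det_mul`.
[cite: LeeSmoothManifolds2013, Prop. 14.9] -/
theorem ContinuousAlternatingMap.apply_comp_eq_det_mul (e : Basis ι ℝ E) (w : E [⋀^ι]→L[ℝ] ℝ)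
    (L : E →L[ℝ] E) (v : ι → E) :
    w (fun i ↦ L (v i)) = LinearMap.det (L : E →ₗ[ℝ] E) * w v :=
  AlternatingMap.apply_linearMap_comp_eq_det_mul e w.toAlternatingMap (L : E →ₗ[ℝ] E) v

/-- The pull-back of a continuous top form along an endomorphism `L` is `det L • w`.
[cite: LeeSmoothManifolds2013, Prop. 14.9] -/
theorem ContinuousAlternatingMap.compContinuousLinearMap_eq_det_smul (e : Basis ι ℝ E)
    (w : E [⋀^ι]→L[ℝ] ℝ) (L : E →L[ℝ] E) :
    w.compContinuousLinearMap L = LinearMap.det (L : E →ₗ[ℝ] E) • w := by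
  ext v
  simp only [ContinuousAlternatingMap.compContinuousLinearMap_apply,
    ContinuousAlternatingMap.smul_apply, smul_eq_mul]
  exact ContinuousAlternatingMap.apply_comp_eq_det_mul e w L v

/-- A continuous top form `w` is `w (e) • D` for any continuous top form `D` normalised by
`D e = 1` on the basis `e` (top forms are one-dimensional). Lee (2013), Prop. 14.9.
[cite: LeeSmoothManifolds2013, Prop. 14.9] -/
theorem ContinuousAlternatingMap.eq_apply_basis_smul (e : Basis ι ℝ E) (w D : E [⋀^ι]→L[ℝ] ℝ)
    (hD : D e = 1) : w = w e • D := by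
  apply ContinuousAlternatingMap.toAlternatingMap_injective
  rw [ContinuousAlternatingMap.toAlternatingMap_smul,
    AlternatingMap.eq_smul_basis_det e w.toAlternatingMap,
    AlternatingMap.eq_smul_basis_det e D.toAlternatingMap]
  simp [hD]

end TopAlgebra

/-! ### Chart representatives, transition maps and the extension-by-zero `MForm.ofChart` -/

section Charts

variable {E : Type*} [NormedAddCommGroup E] [NormedSpace ℝ E]
  {H : Type*} [TopologicalSpace H] {I : ModelWithCorners ℝ E H}
  {M : Type*} [TopologicalSpace M] [ChartedSpace H M] [IsManifold I ∞ M] {k : ℕ}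

/-- The derivative (within `range I`) of the inverse extended chart at `p`, at the chart point
`extChartAt I p x` of a point `x` of the chart source, is the tangent coordinate change from the
chart at `p` to the chart at `x`, at `x` (Mathlib's `TangentBundle.symmL_trivializationAt`).
[folklore] -/
theorem mfderivWithin_extChartAt_symm_apply_eq {p x : M} (hx : x ∈ (extChartAt I p).source) :
    mfderivWithin 𝓘(ℝ, E) I (extChartAt I p).symm (range I) (extChartAt I p x) =
      tangentCoordChange I p x x := by
  have hx' : x ∈ (chartAt H p).source := by rwa [← extChartAt_source I]
  rw [← TangentBundle.symmL_trivializationAt hx', TangentBundle.symmL_trivializationAt_eq_core hx']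

/-- The chart representative of a form `α` at the chart point of `x ∈ (extChartAt I p).source`
evaluates `α x` on the vectors transported by `tangentCoordChange I p x x`. [folklore] -/
theorem _root_.Literature.Geometry.Kaehler.MForm.inChart_apply_extChartAt (α : Literature.Geometry.Kaehler.MForm I M ℝ k) {p x : M}
    (hx : x ∈ (extChartAt I p).source) (v : Fin k → E) :
    α.inChart p (extChartAt I p x) v = α x (fun i ↦ tangentCoordChange I p x x (v i)) := by
  rw [Literature.Geometry.Kaehler.MForm.inChart_apply, mfderivWithin_extChartAt_symm_apply_eq hx]
  rw [PartialEquiv.left_inv _ hx]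
  rfl

/-- **Transition formula** for chart representatives: on the overlap of the charts at `p` and
`q`, the representative in the chart at `p` is the pull-back of the representative in the chart
at `q` along the derivative `tangentCoordChange I p q x` of the transition map (the cocycle
property `tangentCoordChange_comp`). Warner (1983), 2.18; Lee (2013), Lemma 14.16.
[cite: LeeSmoothManifolds2013, Lemma 14.16] -/
theorem _root_.Literature.Geometry.Kaehler.MForm.inChart_extChartAt_eq_comp (α : Literature.Geometry.Kaehler.MForm I M ℝ k) {p q x : M}
    (hp : x ∈ (extChartAt I p).source) (hq : x ∈ (extChartAt I q).source) :
    α.inChart p (extChartAt I p x) =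
      (α.inChart q (extChartAt I q x)).compContinuousLinearMap (tangentCoordChange I p q x) := by
  ext v
  rw [ContinuousAlternatingMap.compContinuousLinearMap_apply, Literature.Geometry.Kaehler.MForm.inChart_apply_extChartAt α hp,
    Literature.Geometry.Kaehler.MForm.inChart_apply_extChartAt α hq]
  congr 1
  funext i
  exact (tangentCoordChange_comp ⟨⟨hp, hq⟩, mem_extChartAt_source (I := I) x⟩).symm

open Classical in
/-- **Extension by zero of a chart pull-back.** For a form `η` on the model space `E` and a
point `p : M`, `MForm.ofChart p η` is the form on `M` equal on the chart source
`(extChartAt I p).source` to the pull-back `(extChartAt I p)^* η`, i.e.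
`x ↦ η (extChartAt I p x) ∘ (tangentCoordChange I x p x)` (the derivative of the extended chart
at `x` read in the chart at `x`, Mathlib's `TangentBundle.continuousLinearMapAt_trivializationAt`),
and to `0` off the chart source. Meaningful when `η` is supported in a compact subset of the
chart target (Lee (2013), proof of Thm. 17.30: "the `n`-form `f dx¹ ∧ ⋯ ∧ dxⁿ` in `U` and `0`
outside `U`"). [cite: LeeSmoothManifolds2013, Thm. 17.30] -/
def _root_.Literature.Geometry.Kaehler.MForm.ofChart (p : M) (η : E → E [⋀^Fin k]→L[ℝ] ℝ) : Literature.Geometry.Kaehler.MForm I M ℝ k := fun x ↦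
  (if x ∈ (extChartAt I p).source then
    (η (extChartAt I p x)).compContinuousLinearMap (tangentCoordChange I x p x) else 0 :
      E [⋀^Fin k]→L[ℝ] ℝ)

/-- `MForm.ofChart p η` on the chart source. [folklore] -/
theorem _root_.Literature.Geometry.Kaehler.MForm.ofChart_apply_of_mem (p : M) (η : E → E [⋀^Fin k]→L[ℝ] ℝ) {x : M}
    (hx : x ∈ (extChartAt I p).source) (v : Fin k → E) :
    (Literature.Geometry.Kaehler.MForm.ofChart p η : Literature.Geometry.Kaehler.MForm I M ℝ k) x v =
      η (extChartAt I p x) (fun i ↦ tangentCoordChange I x p x (v i)) := by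
  simp only [Literature.Geometry.Kaehler.MForm.ofChart, hx, if_true]
  rfl

/-- `MForm.ofChart p η` vanishes off the chart source. [folklore] -/
theorem _root_.Literature.Geometry.Kaehler.MForm.ofChart_apply_of_notMem (p : M) (η : E → E [⋀^Fin k]→L[ℝ] ℝ) {x : M}
    (hx : x ∉ (extChartAt I p).source) : (Literature.Geometry.Kaehler.MForm.ofChart p η : Literature.Geometry.Kaehler.MForm I M ℝ k) x = 0 := by
  simp only [Literature.Geometry.Kaehler.MForm.ofChart, hx, if_false]
  rfl

/-- Where `MForm.ofChart p η` is nonzero, the point lies in the chart source and `η` is nonzero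
at its chart point. [folklore] -/
theorem _root_.Literature.Geometry.Kaehler.MForm.mem_source_of_ofChart_ne_zero (p : M) (η : E → E [⋀^Fin k]→L[ℝ] ℝ) {x : M}
    (hx : (Literature.Geometry.Kaehler.MForm.ofChart p η : Literature.Geometry.Kaehler.MForm I M ℝ k) x ≠ 0) :
    x ∈ (extChartAt I p).source ∧ η (extChartAt I p x) ≠ 0 := by
  by_cases h : x ∈ (extChartAt I p).source
  · refine ⟨h, fun h0 ↦ hx ?_⟩
    ext v
    rw [Literature.Geometry.Kaehler.MForm.ofChart_apply_of_mem p η h, h0]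
    rfl
  · exact absurd (Literature.Geometry.Kaehler.MForm.ofChart_apply_of_notMem p η h) hx

/-- `MForm.ofChart` is additive in the model-space form. [folklore] -/
theorem _root_.Literature.Geometry.Kaehler.MForm.ofChart_add (p : M) (η η' : E → E [⋀^Fin k]→L[ℝ] ℝ) :
    (Literature.Geometry.Kaehler.MForm.ofChart p (η + η') : Literature.Geometry.Kaehler.MForm I M ℝ k) = Literature.Geometry.Kaehler.MForm.ofChart p η + Literature.Geometry.Kaehler.MForm.ofChart p η' := by
  funext x
  by_cases h : x ∈ (extChartAt I p).source
  · ext v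
    simp only [Pi.add_apply, ContinuousAlternatingMap.add_apply, Literature.Geometry.Kaehler.MForm.ofChart_apply_of_mem p _ h]
  · simp only [Pi.add_apply, Literature.Geometry.Kaehler.MForm.ofChart_apply_of_notMem p _ h, add_zero]

/-- `MForm.ofChart` commutes with scalars. [folklore] -/
theorem _root_.Literature.Geometry.Kaehler.MForm.ofChart_smul (p : M) (c : ℝ) (η : E → E [⋀^Fin k]→L[ℝ] ℝ) :
    (Literature.Geometry.Kaehler.MForm.ofChart p (c • η) : Literature.Geometry.Kaehler.MForm I M ℝ k) = c • Literature.Geometry.Kaehler.MForm.ofChart p η := by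
  funext x
  by_cases h : x ∈ (extChartAt I p).source
  · ext v
    simp only [Pi.smul_apply, ContinuousAlternatingMap.smul_apply,
      Literature.Geometry.Kaehler.MForm.ofChart_apply_of_mem p _ h, smul_eq_mul]
  · simp only [Pi.smul_apply, Literature.Geometry.Kaehler.MForm.ofChart_apply_of_notMem p _ h, smul_zero]

/-- The chart representative of `MForm.ofChart p η` in the chart at `q`, at the chart point of
`x` in both chart sources, is the pull-back of `η (extChartAt I p x)` along
`tangentCoordChange I q p x` (cocycle property). [folklore] -/
theorem _root_.Literature.Geometry.Kaehler.MForm.inChart_ofChart_of_mem (p : M) (η : E → E [⋀^Fin k]→L[ℝ] ℝ) {q x : M}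
    (hq : x ∈ (extChartAt I q).source) (hp : x ∈ (extChartAt I p).source) :
    (Literature.Geometry.Kaehler.MForm.ofChart p η : Literature.Geometry.Kaehler.MForm I M ℝ k).inChart q (extChartAt I q x) =
      (η (extChartAt I p x)).compContinuousLinearMap (tangentCoordChange I q p x) := by
  ext v
  rw [Literature.Geometry.Kaehler.MForm.inChart_apply_extChartAt _ hq, Literature.Geometry.Kaehler.MForm.ofChart_apply_of_mem p η hp,
    ContinuousAlternatingMap.compContinuousLinearMap_apply]
  congr 1
  funext i
  exact tangentCoordChange_comp ⟨⟨hq, mem_extChartAt_source (I := I) x⟩, hp⟩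

/-- The chart representative of `MForm.ofChart p η` in the chart at `q` vanishes at chart
points of `x ∉ (extChartAt I p).source`. [folklore] -/
theorem _root_.Literature.Geometry.Kaehler.MForm.inChart_ofChart_of_notMem (p : M) (η : E → E [⋀^Fin k]→L[ℝ] ℝ) {q x : M}
    (hq : x ∈ (extChartAt I q).source) (hp : x ∉ (extChartAt I p).source) :
    (Literature.Geometry.Kaehler.MForm.ofChart p η : Literature.Geometry.Kaehler.MForm I M ℝ k).inChart q (extChartAt I q x) = 0 := by
  ext v
  rw [Literature.Geometry.Kaehler.MForm.inChart_apply_extChartAt _ hq, Literature.Geometry.Kaehler.MForm.ofChart_apply_of_notMem p η hp]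
  rfl


/-! ### Boundaryless manifolds: smoothness of representatives and of `MForm.ofChart` -/

section Boundaryless

/-- The transition map from the chart at `p` to the chart at `q` is smooth on its domain
(Mathlib's `contDiffOn_ext_coord_change`, with the domain spelled out). [folklore] -/
theorem contDiffOn_extChartAt_transition (p q : M) :
    ContDiffOn ℝ ∞ (extChartAt I q ∘ (extChartAt I p).symm)
      ((extChartAt I p).target ∩ (extChartAt I p).symm ⁻¹' (extChartAt I q).source) := by
  have := contDiffOn_ext_coord_change (I := I) (n := ∞) q p
  rwa [PartialEquiv.trans_source, PartialEquiv.symm_source] at this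

variable [I.Boundaryless]

/-- On a boundaryless manifold the tangent coordinate change is the (unrestricted) Fréchet
derivative of the transition map. [folklore] -/
theorem tangentCoordChange_eq_fderiv {p q x : M} :
    tangentCoordChange I p q x =
      fderiv ℝ (extChartAt I q ∘ (extChartAt I p).symm) (extChartAt I p x) := by
  rw [tangentCoordChange_def, I.range_eq_univ, fderivWithin_univ]

omit [IsManifold I ∞ M] in
/-- Preimages of open sets under the inverse extended chart, cut down to the (open) chart
target, are open. [folklore] -/
theorem isOpen_extChartAt_target_inter_preimage (p : M) {U : Set M} (hU : IsOpen U) :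
    IsOpen ((extChartAt I p).target ∩ (extChartAt I p).symm ⁻¹' U) :=
  (continuousOn_extChartAt_symm p).isOpen_inter_preimage (isOpen_extChartAt_target p) hU

/-- The transition map from the chart at `p` to the chart at `q` is smooth at the chart point of
any `x` in both sources. [folklore] -/
theorem contDiffAt_extChartAt_transition {p q x : M} (hp : x ∈ (extChartAt I p).source)
    (hq : x ∈ (extChartAt I q).source) :
    ContDiffAt ℝ ∞ (extChartAt I q ∘ (extChartAt I p).symm) (extChartAt I p x) :=
  (contDiffOn_extChartAt_transition p q).contDiffAt
    ((isOpen_extChartAt_target_inter_preimage (I := I) p (isOpen_extChartAt_source q)).mem_nhds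
      ⟨(extChartAt I p).map_source hp, by rwa [mem_preimage, (extChartAt I p).left_inv hp]⟩)

omit [IsManifold I ∞ M] in
/-- On a boundaryless manifold, chart-wise smoothness of a form at `x` is `ContDiffAt` of the
representative at the chart point. [folklore] -/
theorem _root_.Literature.Geometry.Kaehler.IsSmoothForm.contDiffAt {α : Literature.Geometry.Kaehler.MForm I M ℝ k} (hα : Literature.Geometry.Kaehler.IsSmoothForm α) (x : M) :
    ContDiffAt ℝ ∞ (α.inChart x) (extChartAt I x x) := by
  have := hα x
  rwa [I.range_eq_univ, contDiffWithinAt_univ] at this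

/-- On a boundaryless manifold, `dα` at `x` is the exterior derivative of the chart
representative at the chart point (the derivative of the extended chart at its centre is the
identity, `mfderiv_extChartAt_self`). [folklore] -/
theorem mextDeriv_apply_eq_extDeriv (α : Literature.Geometry.Kaehler.MForm I M ℝ k) (x : M) :
    Literature.Geometry.Kaehler.mextDeriv α x = extDeriv (α.inChart x) (extChartAt I x x) := by
  rw [Literature.Geometry.Kaehler.mextDeriv, mfderiv_extChartAt_self, I.range_eq_univ, extDerivWithin_univ]
  ext v
  rfl

/-- Near the chart point of `x ∈ (extChartAt I p).source`, the representative of a form in the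
chart at `p` is the pull-back of its representative in the chart at `x` along the transition
map. [cite: LeeSmoothManifolds2013, Lemma 14.16] -/
theorem _root_.Literature.Geometry.Kaehler.MForm.inChart_eventuallyEq_pullback (α : Literature.Geometry.Kaehler.MForm I M ℝ k) {p x : M}
    (hx : x ∈ (extChartAt I p).source) :
    α.inChart p =ᶠ[𝓝 (extChartAt I p x)] fun y ↦
      (α.inChart x ((extChartAt I x ∘ (extChartAt I p).symm) y)).compContinuousLinearMap
        (fderiv ℝ (extChartAt I x ∘ (extChartAt I p).symm) y) := by
  have hO := isOpen_extChartAt_target_inter_preimage (I := I) p (isOpen_extChartAt_source (I := I) x)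
  have hyO : extChartAt I p x ∈
      (extChartAt I p).target ∩ (extChartAt I p).symm ⁻¹' (extChartAt I x).source :=
    ⟨(extChartAt I p).map_source hx,
      by rw [mem_preimage, (extChartAt I p).left_inv hx]; exact mem_extChartAt_source x⟩
  filter_upwards [hO.mem_nhds hyO] with y hy
  have hx' : (extChartAt I p).symm y ∈ (extChartAt I p).source := (extChartAt I p).map_target hy.1
  have h1 := Literature.Geometry.Kaehler.MForm.inChart_extChartAt_eq_comp α hx' hy.2
  rw [(extChartAt I p).right_inv hy.1] at h1
  rw [h1, tangentCoordChange_eq_fderiv, (extChartAt I p).right_inv hy.1]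
  rfl

/-- **Chart representatives of smooth forms are smooth on the whole chart target** (not only
at the centre): consequence of the transition formula and the smoothness of the transition
maps. Warner (1983), 2.18; Lee (2013), Lemma 14.16. [cite: LeeSmoothManifolds2013, Lemma 14.16] -/
theorem _root_.Literature.Geometry.Kaehler.IsSmoothForm.contDiffOn_inChart {α : Literature.Geometry.Kaehler.MForm I M ℝ k} (hα : Literature.Geometry.Kaehler.IsSmoothForm α) (p : M) :
    ContDiffOn ℝ ∞ (α.inChart p) (extChartAt I p).target := by
  intro y₀ hy₀
  suffices h : ContDiffAt ℝ ∞ (α.inChart p) y₀ from h.contDiffWithinAt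
  have hx₀ : (extChartAt I p).symm y₀ ∈ (extChartAt I p).source := (extChartAt I p).map_target hy₀
  have heq := Literature.Geometry.Kaehler.MForm.inChart_eventuallyEq_pullback α hx₀
  rw [(extChartAt I p).right_inv hy₀] at heq
  refine ContDiffAt.congr_of_eventuallyEq ?_ heq
  have hτ : ContDiffAt ℝ ∞ (extChartAt I ((extChartAt I p).symm y₀) ∘ (extChartAt I p).symm) y₀ := by
    have := contDiffAt_extChartAt_transition hx₀ (mem_extChartAt_source ((extChartAt I p).symm y₀))
    rwa [(extChartAt I p).right_inv hy₀] at this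
  have h1 : ContDiffAt ℝ ∞ (α.inChart ((extChartAt I p).symm y₀))
      ((extChartAt I ((extChartAt I p).symm y₀) ∘ (extChartAt I p).symm) y₀) := by
    have : (extChartAt I ((extChartAt I p).symm y₀) ∘ (extChartAt I p).symm) y₀ =
        extChartAt I ((extChartAt I p).symm y₀) ((extChartAt I p).symm y₀) := rfl
    rw [this]
    exact hα.contDiffAt _
  exact ContDiffAt.continuousAlternatingMapCompContinuousLinearMap (h1.comp y₀ hτ)
    (hτ.fderiv_right (by simp))

omit [IsManifold I ∞ M] [I.Boundaryless] in
/-- A smooth function times a smooth form is a smooth form (the product `ψ • α` is the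
pointwise one, `(ψ • α) x = ψ x • α x`). [folklore] -/
theorem _root_.Literature.Geometry.Kaehler.IsSmoothForm.fun_smul {ψ : M → ℝ} (hψ : ContMDiff I 𝓘(ℝ) ∞ ψ) {α : Literature.Geometry.Kaehler.MForm I M ℝ k}
    (hα : Literature.Geometry.Kaehler.IsSmoothForm α) : Literature.Geometry.Kaehler.IsSmoothForm (ψ • α) := by
  intro x
  have h1 : ContDiffWithinAt ℝ ∞ (ψ ∘ (extChartAt I x).symm) (range I) (extChartAt I x x) := by
    have := (contMDiffAt_iff.1 (hψ x)).2
    simpa only [extChartAt_model_space_eq_id, PartialEquiv.refl_coe, id_comp] using this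
  have h2 : Literature.Geometry.Kaehler.MForm.inChart (ψ • α) x = fun y ↦ (ψ ∘ (extChartAt I x).symm) y • α.inChart x y := by
    funext y
    ext v
    rfl
  rw [h2]
  exact h1.smul (hα x)

omit [I.Boundaryless] in
/-- Off the set `(extChartAt I p).symm '' tsupport η`, the form `MForm.ofChart p η` vanishes.
[folklore] -/
theorem _root_.Literature.Geometry.Kaehler.MForm.ofChart_eq_zero_of_notMem (p : M) (η : E → E [⋀^Fin k]→L[ℝ] ℝ) {x : M}
    (hx : x ∉ (extChartAt I p).symm '' tsupport η) : (Literature.Geometry.Kaehler.MForm.ofChart p η : Literature.Geometry.Kaehler.MForm I M ℝ k) x = 0 := by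
  by_contra h
  obtain ⟨hxs, hne⟩ := Literature.Geometry.Kaehler.MForm.mem_source_of_ofChart_ne_zero p η h
  exact hx ⟨extChartAt I p x, subset_tsupport η hne, (extChartAt I p).left_inv hxs⟩

omit [IsManifold I ∞ M] [I.Boundaryless] in
/-- The set `(extChartAt I p).symm '' tsupport η` is compact when `η` has compact support in
the chart target. [folklore] -/
theorem isCompact_symm_image_tsupport (p : M) {η : E → E [⋀^Fin k]→L[ℝ] ℝ}
    (hηc : HasCompactSupport η) (hηt : tsupport η ⊆ (extChartAt I p).target) :
    IsCompact ((extChartAt I p).symm '' tsupport η) :=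
  hηc.image_of_continuousOn ((continuousOn_extChartAt_symm p).mono hηt)

/-- Near the chart point of `x ∈ (extChartAt I p).source`, the representative of
`MForm.ofChart p η` in the chart at `x` is the pull-back of `η` along the transition map
`extChartAt I p ∘ (extChartAt I x).symm`. [folklore] -/
theorem _root_.Literature.Geometry.Kaehler.MForm.inChart_ofChart_eventuallyEq_of_mem (p : M) (η : E → E [⋀^Fin k]→L[ℝ] ℝ) {x : M}
    (hx : x ∈ (extChartAt I p).source) :
    (Literature.Geometry.Kaehler.MForm.ofChart p η : Literature.Geometry.Kaehler.MForm I M ℝ k).inChart x =ᶠ[𝓝 (extChartAt I x x)] fun y ↦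
      (η ((extChartAt I p ∘ (extChartAt I x).symm) y)).compContinuousLinearMap
        (fderiv ℝ (extChartAt I p ∘ (extChartAt I x).symm) y) := by
  have hO := isOpen_extChartAt_target_inter_preimage (I := I) x (isOpen_extChartAt_source (I := I) p)
  have hyO : extChartAt I x x ∈
      (extChartAt I x).target ∩ (extChartAt I x).symm ⁻¹' (extChartAt I p).source :=
    ⟨mem_extChartAt_target x, by rwa [mem_preimage, extChartAt_to_inv]⟩
  filter_upwards [hO.mem_nhds hyO] with y hy
  have hx' : (extChartAt I x).symm y ∈ (extChartAt I x).source := (extChartAt I x).map_target hy.1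
  have h1 := Literature.Geometry.Kaehler.MForm.inChart_ofChart_of_mem p η hx' hy.2
  rw [(extChartAt I x).right_inv hy.1] at h1
  rw [h1, tangentCoordChange_eq_fderiv, (extChartAt I x).right_inv hy.1]
  rfl

variable [T2Space M]

/-- Near the chart point of `x ∉ (extChartAt I p).source`, the representative of
`MForm.ofChart p η` in the chart at `x` vanishes, when `η` has compact support in the chart
target at `p`. [folklore] -/
theorem _root_.Literature.Geometry.Kaehler.MForm.inChart_ofChart_eventuallyEq_zero (p : M) {η : E → E [⋀^Fin k]→L[ℝ] ℝ}
    (hηc : HasCompactSupport η) (hηt : tsupport η ⊆ (extChartAt I p).target) {x : M}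
    (hx : x ∉ (extChartAt I p).source) :
    (Literature.Geometry.Kaehler.MForm.ofChart p η : Literature.Geometry.Kaehler.MForm I M ℝ k).inChart x =ᶠ[𝓝 (extChartAt I x x)] fun _ ↦ 0 := by
  classical
  set K := (extChartAt I p).symm '' tsupport η with hK
  have hKc : IsCompact K := isCompact_symm_image_tsupport p hηc hηt
  have hxK : x ∉ K := fun ⟨y, hy, hyx⟩ ↦ hx (hyx ▸ (extChartAt I p).map_target (hηt hy))
  have hO := isOpen_extChartAt_target_inter_preimage (I := I) x hKc.isClosed.isOpen_compl
  have hyO : extChartAt I x x ∈ (extChartAt I x).target ∩ (extChartAt I x).symm ⁻¹' Kᶜ :=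
    ⟨mem_extChartAt_target x, by rwa [mem_preimage, extChartAt_to_inv]⟩
  filter_upwards [hO.mem_nhds hyO] with y hy
  ext v
  rw [Literature.Geometry.Kaehler.MForm.inChart_apply, Literature.Geometry.Kaehler.MForm.ofChart_eq_zero_of_notMem p η hy.2]
  rfl

/-- **`MForm.ofChart p η` is a smooth form** when `η` is smooth with compact support inside the
chart target (Lee (2013), proof of Thm. 17.30: the extension by zero of `f dx¹ ∧ ⋯ ∧ dxⁿ` is
smooth). [cite: LeeSmoothManifolds2013, Thm. 17.30] -/
theorem isSmoothForm_ofChart (p : M) {η : E → E [⋀^Fin k]→L[ℝ] ℝ} (hη : ContDiff ℝ ∞ η)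
    (hηc : HasCompactSupport η) (hηt : tsupport η ⊆ (extChartAt I p).target) :
    Literature.Geometry.Kaehler.IsSmoothForm (Literature.Geometry.Kaehler.MForm.ofChart p η : Literature.Geometry.Kaehler.MForm I M ℝ k) := by
  intro x
  rw [I.range_eq_univ, contDiffWithinAt_univ]
  by_cases hx : x ∈ (extChartAt I p).source
  · refine ContDiffAt.congr_of_eventuallyEq ?_ (Literature.Geometry.Kaehler.MForm.inChart_ofChart_eventuallyEq_of_mem p η hx)
    have hτ : ContDiffAt ℝ ∞ (extChartAt I p ∘ (extChartAt I x).symm) (extChartAt I x x) :=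
      contDiffAt_extChartAt_transition (mem_extChartAt_source x) hx
    exact ContDiffAt.continuousAlternatingMapCompContinuousLinearMap (hη.contDiffAt.comp _ hτ)
      (hτ.fderiv_right (by simp))
  · exact contDiffAt_const.congr_of_eventuallyEq
      (Literature.Geometry.Kaehler.MForm.inChart_ofChart_eventuallyEq_zero p hηc hηt hx)

/-- **`d` commutes with `MForm.ofChart`**: for `η` smooth with compact support inside the chart
target, `d (ofChart p η) = ofChart p (dη)` (naturality of `d` under the chart,
`extDeriv_pullback`, plus the extension by zero). Lee (2013), Prop. 14.26.
[cite: LeeSmoothManifolds2013, Prop. 14.26] -/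
theorem mextDeriv_ofChart (p : M) {η : E → E [⋀^Fin k]→L[ℝ] ℝ} (hη : ContDiff ℝ ∞ η)
    (hηc : HasCompactSupport η) (hηt : tsupport η ⊆ (extChartAt I p).target) :
    Literature.Geometry.Kaehler.mextDeriv (Literature.Geometry.Kaehler.MForm.ofChart p η : Literature.Geometry.Kaehler.MForm I M ℝ k) = Literature.Geometry.Kaehler.MForm.ofChart p (extDeriv η) := by
  funext x
  rw [mextDeriv_apply_eq_extDeriv]
  by_cases hx : x ∈ (extChartAt I p).source
  · rw [(Literature.Geometry.Kaehler.MForm.inChart_ofChart_eventuallyEq_of_mem p η hx).extDeriv_eq]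
    have hτ : ContDiffAt ℝ ∞ (extChartAt I p ∘ (extChartAt I x).symm) (extChartAt I x x) :=
      contDiffAt_extChartAt_transition (mem_extChartAt_source x) hx
    rw [extDeriv_pullback (hη.differentiable (by simp) _) hτ
      (by rw [minSmoothness_of_isRCLikeNormedField]; exact WithTop.coe_le_coe.2 le_top)]
    have : (Literature.Geometry.Kaehler.MForm.ofChart p (extDeriv η) : Literature.Geometry.Kaehler.MForm I M ℝ (k + 1)) x =
        (extDeriv η (extChartAt I p x)).compContinuousLinearMap (tangentCoordChange I x p x) := by
      simp only [Literature.Geometry.Kaehler.MForm.ofChart, hx, if_true]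
    rw [this, ← tangentCoordChange_eq_fderiv]
    simp only [Function.comp_apply, extChartAt_to_inv]
  · rw [(Literature.Geometry.Kaehler.MForm.inChart_ofChart_eventuallyEq_zero p hηc hηt hx).extDeriv_eq,
      Literature.Geometry.Kaehler.MForm.ofChart_apply_of_notMem p _ hx, extDeriv, fderiv_fun_const, Pi.zero_apply,
      ← ContinuousAlternatingMap.alternatizeUncurryFinCLM_apply, map_zero]
    rfl

end Boundaryless

end Charts


/-! ### Orientation signs and the integral of a chart bump form -/

section Sign

/-- `Real.sign` is multiplicative. [folklore] -/
theorem real_sign_mul (a b : ℝ) : Real.sign (a * b) = Real.sign a * Real.sign b := by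
  rcases lt_trichotomy a 0 with ha | rfl | ha
  · rcases lt_trichotomy b 0 with hb | rfl | hb
    · rw [Real.sign_of_pos (mul_pos_of_neg_of_neg ha hb), Real.sign_of_neg ha, Real.sign_of_neg hb]
      norm_num
    · simp [Real.sign_zero]
    · rw [Real.sign_of_neg (mul_neg_of_neg_of_pos ha hb), Real.sign_of_neg ha, Real.sign_of_pos hb]
      norm_num
  · simp [Real.sign_zero]
  · rcases lt_trichotomy b 0 with hb | rfl | hb
    · rw [Real.sign_of_neg (mul_neg_of_pos_of_neg ha hb), Real.sign_of_pos ha, Real.sign_of_neg hb]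
      norm_num
    · simp [Real.sign_zero]
    · rw [Real.sign_of_pos (mul_pos ha hb), Real.sign_of_pos ha, Real.sign_of_pos hb]
      norm_num

/-- `sign d * d = |d|`. [folklore] -/
theorem real_sign_mul_self (d : ℝ) : Real.sign d * d = |d| := by
  rcases lt_trichotomy d 0 with h | rfl | h
  · rw [Real.sign_of_neg h, abs_of_neg h]
    ring
  · simp
  · rw [Real.sign_of_pos h, abs_of_pos h]
    ring

end Sign

section Integral

variable {E : Type*} [NormedAddCommGroup E] [NormedSpace ℝ E] [FiniteDimensional ℝ E]
  {n : ℕ} [Fact (finrank ℝ E = n)]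
  {H : Type*} [TopologicalSpace H] {I : ModelWithCorners ℝ E H}
  {M : Type*} [TopologicalSpace M] [ChartedSpace H M] [IsManifold I ∞ M]
  (o : (x : M) → Orientation ℝ (TangentSpace I x) (Fin n))

omit [IsManifold I ∞ M] in
/-- The orientation `o x` as an alternating top form on the model space `E` (a representative
`(o x).someVector` of the ray `o x`, read through the identification `TangentSpace I x = E`);
only its sign on frames matters. Lee (2013), Ch. 15, pointwise orientations.
[cite: LeeSmoothManifolds2013, Prop. 15.6] -/
def orientationForm (x : M) : E [⋀^Fin n]→ₗ[ℝ] ℝ := (o x).someVector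

omit [IsManifold I ∞ M] in
/-- The chart sign is the sign of the orientation form on the chart frame (definitional
unfolding of `chartSign` through `orientationForm`). [folklore] -/
theorem chartSign_eq_sign_orientationForm (p : M) (y : E) :
    chartSign o p y = Real.sign (orientationForm o ((extChartAt I p).symm y) fun j ↦
      mfderivWithin 𝓘(ℝ, E) I (extChartAt I p).symm (range I) y (modelBasis E n j)) :=
  rfl

/-- The chart sign at the chart point of `x ∈ (extChartAt I p).source` factors as the sign of
the Jacobian determinant of `tangentCoordChange I p x x` times the sign of the orientation
form at `x` on the reference basis (`AlternatingMap.eq_smul_basis_det`). Lee (2013), Ch. 15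
(pointwise orientations vs. oriented charts). [cite: LeeSmoothManifolds2013, Prop. 15.6] -/
theorem chartSign_extChartAt {p x : M} (hx : x ∈ (extChartAt I p).source) :
    chartSign o p (extChartAt I p x) =
      Real.sign (LinearMap.det (tangentCoordChange I p x x : E →ₗ[ℝ] E)) *
        Real.sign (orientationForm o x (modelBasis E n)) := by
  have h1 : chartSign o p (extChartAt I p x) = Real.sign (orientationForm o x fun j ↦
      tangentCoordChange I p x x (modelBasis E n j)) := by
    rw [chartSign_eq_sign_orientationForm, mfderivWithin_extChartAt_symm_apply_eq hx,
      (extChartAt I p).left_inv hx]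
    rfl
  have h2 := AlternatingMap.apply_linearMap_comp_eq_det_mul (modelBasis E n) (orientationForm o x)
    (tangentCoordChange I p x x : E →ₗ[ℝ] E) (modelBasis E n)
  simp only [ContinuousLinearMap.coe_coe] at h2
  rw [h1, h2, real_sign_mul]

/-- **Transformation of chart signs under a change of chart**: at a point of the overlap, the
sign of the chart at `i` is the sign of the Jacobian determinant of the transition map times
the sign of the chart at `p`. Lee (2013), Prop. 15.6 / Exercise 15.11.
[cite: LeeSmoothManifolds2013, Prop. 15.6] -/
theorem chartSign_extChartAt_eq_sign_det_mul {i p x : M} (hi : x ∈ (extChartAt I i).source)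
    (hp : x ∈ (extChartAt I p).source) :
    chartSign o i (extChartAt I i x) =
      Real.sign (LinearMap.det (tangentCoordChange I i p x : E →ₗ[ℝ] E)) *
        chartSign o p (extChartAt I p x) := by
  have hcomp : (tangentCoordChange I i x x : E →ₗ[ℝ] E) =
      (tangentCoordChange I p x x : E →ₗ[ℝ] E).comp (tangentCoordChange I i p x : E →ₗ[ℝ] E) := by
    apply LinearMap.ext
    intro v
    simp only [ContinuousLinearMap.coe_coe, LinearMap.coe_comp, Function.comp_apply]
    exact (tangentCoordChange_comp ⟨⟨hi, hp⟩, mem_extChartAt_source (I := I) x⟩).symm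
  rw [chartSign_extChartAt o hi, chartSign_extChartAt o hp, hcomp, LinearMap.det_comp,
    real_sign_mul]
  ring

variable [MeasurableSpace E] [BorelSpace E] [T2Space M] [SigmaCompactSpace M]

/-- **The integral of a chart bump form.** On a closed manifold, for a continuous compactly
supported function `g` on the model space supported in the chart target at `p`, on whose support
the chart sign is the constant `ε`, and a top form `D` normalised on the reference basis, the
integral of the extension by zero `ofChart p (g • D)` is `ε ∫ g ∂(modelBasis E n).addHaar`.
The computation behind Lee (2013), Prop. 16.4/16.5 (independence of the chart and of the
partition of unity, via the change of variables formula and `∑ᵢ ρᵢ = 1`).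
[cite: LeeSmoothManifolds2013, Prop. 16.5] -/
theorem _root_.Literature.Geometry.Kaehler.MForm.integral_ofChart_smul [CompactSpace M] [I.Boundaryless] (p : M)
    {D : E [⋀^Fin n]→L[ℝ] ℝ} (hD : D (modelBasis E n) = 1) {g : E → ℝ} (hg : Continuous g)
    (hgc : HasCompactSupport g) (hgt : tsupport g ⊆ (extChartAt I p).target) {ε : ℝ}
    (hε : ∀ y ∈ tsupport g, chartSign o p y = ε) :
    Literature.Geometry.Kaehler.MForm.integral o (Literature.Geometry.Kaehler.MForm.ofChart p (fun y ↦ g y • D) : Literature.Geometry.Kaehler.MForm I M ℝ n) =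
      ε * ∫ y, g y ∂(modelBasis E n).addHaar := by
  set e := modelBasis E n with he
  set ρ := chartPartitionOfUnity I M with hρ
  set β : Literature.Geometry.Kaehler.MForm I M ℝ n := Literature.Geometry.Kaehler.MForm.ofChart p (fun y ↦ g y • D) with hβ
  -- the functions `G i z = ρ i (chart⁻¹ z) * g z` on the model space
  set G : M → E → ℝ := fun i z ↦ ρ i ((extChartAt I p).symm z) * g z with hG
  have hρsub : ∀ i, tsupport (ρ i) ⊆ (extChartAt I i).source := fun i ↦ by
    rw [extChartAt_source]; exact chartPartitionOfUnity_isSubordinate i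
  have hg0 : ∀ z, z ∉ (extChartAt I p).target → g z = 0 := fun z hz ↦
    image_eq_zero_of_notMem_tsupport fun h ↦ hz (hgt h)
  -- Step 1: each chart integral equals `ε * ∫ G i`.
  have hstep : ∀ i : M,
      ∫ y in (extChartAt I i).target, chartSign o i y * ρ i ((extChartAt I i).symm y) *
        β.inChart i y e ∂e.addHaar = ε * ∫ z, G i z ∂e.addHaar := by
    intro i
    set O := (extChartAt I i).target ∩ (extChartAt I i).symm ⁻¹' (extChartAt I p).source with hO
    have hO_open : IsOpen O :=
      isOpen_extChartAt_target_inter_preimage (I := I) i (isOpen_extChartAt_source (I := I) p)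
    set τ := extChartAt I p ∘ (extChartAt I i).symm with hτ
    -- the integrand vanishes off `O`
    have hzero : ∀ y ∈ (extChartAt I i).target \ O,
        chartSign o i y * ρ i ((extChartAt I i).symm y) * β.inChart i y e = 0 := by
      intro y hy
      have hyp : (extChartAt I i).symm y ∉ (extChartAt I p).source := fun h ↦ hy.2 ⟨hy.1, h⟩
      have : β.inChart i y e = 0 := by
        rw [Literature.Geometry.Kaehler.MForm.inChart_apply, hβ, Literature.Geometry.Kaehler.MForm.ofChart_apply_of_notMem p _ hyp]
        rfl
      rw [this, mul_zero]
    -- the integrand on `O`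
    have hon : ∀ y ∈ O, chartSign o i y * ρ i ((extChartAt I i).symm y) * β.inChart i y e =
        ε * (|(fderiv ℝ τ y).det| * G i (τ y)) := by
      intro y hy
      set x := (extChartAt I i).symm y with hx
      have hxi : x ∈ (extChartAt I i).source := (extChartAt I i).map_target hy.1
      have hxp : x ∈ (extChartAt I p).source := hy.2
      have hyx : y = extChartAt I i x := ((extChartAt I i).right_inv hy.1).symm
      have h1 : β.inChart i y e = g (extChartAt I p x) *
          LinearMap.det (tangentCoordChange I i p x : E →ₗ[ℝ] E) := by
        rw [hyx, hβ, Literature.Geometry.Kaehler.MForm.inChart_ofChart_of_mem p _ hxi hxp,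
          ContinuousAlternatingMap.compContinuousLinearMap_eq_det_smul e]
        simp only [ContinuousAlternatingMap.smul_apply, smul_eq_mul, hD]
        ring
      have h2 : chartSign o i y = Real.sign (LinearMap.det (tangentCoordChange I i p x : E →ₗ[ℝ] E))
          * chartSign o p (extChartAt I p x) := by
        rw [hyx]; exact chartSign_extChartAt_eq_sign_det_mul o hxi hxp
      have h3 : tangentCoordChange I i p x = fderiv ℝ τ y := by
        rw [tangentCoordChange_eq_fderiv, ← hyx]
      have h4 : G i (τ y) = ρ i x * g (extChartAt I p x) := by
        simp only [hG, hτ, Function.comp_apply, ← hx, (extChartAt I p).left_inv hxp]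
      rw [h1, h2, h4, ← h3]
      by_cases hgx : g (extChartAt I p x) = 0
      · simp only [hgx, zero_mul, mul_zero]
      · have hε' : chartSign o p (extChartAt I p x) = ε := hε _ (subset_tsupport g hgx)
        rw [hε', ContinuousLinearMap.det, ← real_sign_mul_self]
        ring
    -- change of variables on `O`
    have hτdiff : ∀ y ∈ O, HasFDerivWithinAt τ (fderiv ℝ τ y) O y := fun y hy ↦
      (((contDiffOn_extChartAt_transition i p).contDiffAt (hO_open.mem_nhds hy)).differentiableAt
        (by simp)).hasFDerivAt.hasFDerivWithinAt
    have hτinj : InjOn τ O := by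
      intro y hy y' hy' h
      have h' : (extChartAt I i).symm y = (extChartAt I i).symm y' :=
        (extChartAt I p).injOn hy.2 hy'.2 h
      rw [← (extChartAt I i).right_inv hy.1, ← (extChartAt I i).right_inv hy'.1, h']
    have himage : τ '' O = (extChartAt I p).target ∩ (extChartAt I p).symm ⁻¹' (extChartAt I i).source := by
      apply Subset.antisymm
      · rintro _ ⟨y, hy, rfl⟩
        refine ⟨(extChartAt I p).map_source hy.2, ?_⟩
        rw [mem_preimage, hτ, Function.comp_apply, (extChartAt I p).left_inv hy.2]
        exact (extChartAt I i).map_target hy.1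
      · rintro z ⟨hz, hzi⟩
        refine ⟨extChartAt I i ((extChartAt I p).symm z), ⟨(extChartAt I i).map_source hzi, ?_⟩, ?_⟩
        · rw [mem_preimage, (extChartAt I i).left_inv hzi]
          exact (extChartAt I p).map_target hz
        · rw [hτ, Function.comp_apply, (extChartAt I i).left_inv hzi, (extChartAt I p).right_inv hz]
    have hGzero : ∀ z, z ∉ τ '' O → G i z = 0 := by
      intro z hz
      rw [himage] at hz
      by_cases hzt : z ∈ (extChartAt I p).target
      · have : (extChartAt I p).symm z ∉ (extChartAt I i).source := fun h ↦ hz ⟨hzt, h⟩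
        simp only [hG, image_eq_zero_of_notMem_tsupport fun h ↦ this (hρsub i h), zero_mul]
      · simp only [hG, hg0 z hzt, mul_zero]
    calc ∫ y in (extChartAt I i).target, chartSign o i y * ρ i ((extChartAt I i).symm y) *
          β.inChart i y e ∂e.addHaar
        = ∫ y in O, chartSign o i y * ρ i ((extChartAt I i).symm y) * β.inChart i y e ∂e.addHaar :=
          setIntegral_eq_of_subset_of_forall_sdiff_eq_zero (isOpen_extChartAt_target i).measurableSet
            inter_subset_left hzero
      _ = ∫ y in O, ε * (|(fderiv ℝ τ y).det| * G i (τ y)) ∂e.addHaar :=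
          setIntegral_congr_fun hO_open.measurableSet hon
      _ = ε * ∫ y in O, |(fderiv ℝ τ y).det| • G i (τ y) ∂e.addHaar := by
          rw [integral_const_mul]; rfl
      _ = ε * ∫ z in τ '' O, G i z ∂e.addHaar := by
          rw [integral_image_eq_integral_abs_det_fderiv_smul e.addHaar hO_open.measurableSet hτdiff hτinj]
      _ = ε * ∫ z, G i z ∂e.addHaar := by
          rw [setIntegral_eq_integral_of_forall_compl_eq_zero fun z hz ↦ hGzero z hz]
  -- Step 2: sum over the (finitely many relevant) indices.
  have hfin : {i : M | (support (ρ i)).Nonempty}.Finite :=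
    ρ.locallyFinite.finite_nonempty_of_compact
  set S := hfin.toFinset with hS
  have hSmem : ∀ i, i ∉ S → ∀ x, ρ i x = 0 := by
    intro i hi x
    by_contra hx
    exact hi (hfin.mem_toFinset.2 ⟨x, hx⟩)
  have hGint : ∀ i, Integrable (G i) e.addHaar := by
    intro i
    refine Continuous.integrable_of_hasCompactSupport ?_ hgc.mul_left
    refine continuous_iff_continuousAt.2 fun z ↦ ?_
    by_cases hz : z ∈ (extChartAt I p).target
    · have hc : ContinuousOn (fun z ↦ ρ i ((extChartAt I p).symm z)) (extChartAt I p).target :=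
        (map_continuous (ρ i)).comp_continuousOn (continuousOn_extChartAt_symm p)
      exact (hc.continuousAt ((isOpen_extChartAt_target p).mem_nhds hz)).mul hg.continuousAt
    · have hz' : z ∉ tsupport g := fun h ↦ hz (hgt h)
      have heq : G i =ᶠ[𝓝 z] fun _ ↦ 0 := by
        filter_upwards [(isClosed_tsupport g).isOpen_compl.mem_nhds hz'] with w hw
        simp only [hG, image_eq_zero_of_notMem_tsupport hw, mul_zero]
      exact (continuousAt_congr heq).2 continuousAt_const
  have hsum1 : ∀ x : M, ∑ i ∈ S, ρ i x = 1 := by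
    intro x
    have hsub : support (fun i ↦ ρ i x) ⊆ (S : Set M) := by
      intro i hi
      simp only [Finset.mem_coe]
      by_contra h
      exact hi (hSmem i h x)
    exact (finsum_eq_sum_of_support_subset _ hsub).symm.trans (ρ.sum_eq_one (mem_univ x))
  have hsumG : ∀ z, ∑ i ∈ S, G i z = g z := by
    intro z
    simp only [hG]
    rw [← Finset.sum_mul, hsum1, one_mul]
  have hG0 : ∀ i, i ∉ S → G i = fun _ ↦ 0 := by
    intro i hi
    funext z
    simp only [hG, hSmem i hi, zero_mul]
  -- assemble
  have hLHS : Literature.Geometry.Kaehler.MForm.integral o β = ∑ᶠ i, ∫ y in (extChartAt I i).target,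
      chartSign o i y * ρ i ((extChartAt I i).symm y) * β.inChart i y e ∂e.addHaar := rfl
  have hsupp : support (fun i ↦ ∫ y in (extChartAt I i).target,
      chartSign o i y * ρ i ((extChartAt I i).symm y) * β.inChart i y e ∂e.addHaar) ⊆ (S : Set M) := by
    intro i hi
    simp only [Finset.mem_coe]
    by_contra h
    apply hi
    simp only [hstep i, hG0 i h, integral_zero, mul_zero]
  rw [hLHS, finsum_eq_sum_of_support_subset _ hsupp, Finset.sum_congr rfl fun i _ ↦ hstep i,
    ← Finset.mul_sum, ← integral_finsetSum S fun i _ ↦ hGint i]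
  congr 1
  exact integral_congr_ae (Filter.Eventually.of_forall hsumG)


end Integral

/-! ### The chart density of a top form supported in a chart, and its integral -/

section Density

variable {E : Type*} [NormedAddCommGroup E] [NormedSpace ℝ E] [FiniteDimensional ℝ E]
  {n : ℕ} [Fact (finrank ℝ E = n)]
  {H : Type*} [TopologicalSpace H] {I : ModelWithCorners ℝ E H}
  {M : Type*} [TopologicalSpace M] [ChartedSpace H M]

open Classical in
/-- The **chart density** of a top-degree form `α` in the chart at `p`: the coefficient
`y ↦ α̂_p(y)(e₁, …, eₙ)` of the chart representative on the reference basis `e = modelBasis E n`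
(so that `α̂_p(y) = (chartDensity p α y) • dx¹ ∧ ⋯ ∧ dxⁿ`), extended by `0` off the chart target.
Lee (2013), Ch. 16, eq. (16.1) (`ω = f dx¹ ∧ ⋯ ∧ dxⁿ` in a chart). [cite: LeeSmoothManifolds2013, Prop. 16.5] -/
def _root_.Literature.Geometry.Kaehler.MForm.chartDensity (p : M) (α : Literature.Geometry.Kaehler.MForm I M ℝ n) : E → ℝ := fun y ↦
  if y ∈ (extChartAt I p).target then α.inChart p y (modelBasis E n) else 0

/-- **Representation of a top form supported in a chart**: if `α` vanishes off the source of the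
chart at `p`, then `α` is the extension by zero of the chart pull-back of
`(chartDensity p α) • D`, for any top form `D` on the model space normalised on the reference
basis. Lee (2013), Prop. 14.9 / eq. (16.1). [cite: LeeSmoothManifolds2013, Prop. 16.5] -/
theorem _root_.Literature.Geometry.Kaehler.MForm.eq_ofChart_chartDensity_smul [IsManifold I ∞ M] (p : M) {D : E [⋀^Fin n]→L[ℝ] ℝ}
    (hD : D (modelBasis E n) = 1) {α : Literature.Geometry.Kaehler.MForm I M ℝ n}
    (hα : ∀ x ∉ (extChartAt I p).source, α x = 0) :
    α = Literature.Geometry.Kaehler.MForm.ofChart p (fun y ↦ Literature.Geometry.Kaehler.MForm.chartDensity p α y • D) := by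
  funext x
  by_cases hx : x ∈ (extChartAt I p).source
  · have hcomp : (tangentCoordChange I x p x : E →ₗ[ℝ] E).comp
        (tangentCoordChange I p x x : E →ₗ[ℝ] E) = LinearMap.id := by
      apply LinearMap.ext
      intro v
      simp only [ContinuousLinearMap.coe_coe, LinearMap.coe_comp, Function.comp_apply,
        LinearMap.id_coe, id_eq]
      rw [tangentCoordChange_comp ⟨⟨hx, mem_extChartAt_source (I := I) x⟩, hx⟩]
      exact tangentCoordChange_self hx
    have hdet : LinearMap.det (tangentCoordChange I x p x : E →ₗ[ℝ] E) *
        LinearMap.det (tangentCoordChange I p x x : E →ₗ[ℝ] E) = 1 := by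
      rw [← LinearMap.det_comp, hcomp, LinearMap.det_id]
    have hR : (Literature.Geometry.Kaehler.MForm.ofChart p (fun y ↦ Literature.Geometry.Kaehler.MForm.chartDensity p α y • D) : Literature.Geometry.Kaehler.MForm I M ℝ n) x =
        (Literature.Geometry.Kaehler.MForm.chartDensity p α (extChartAt I p x) • D).compContinuousLinearMap
          (tangentCoordChange I x p x) := by
      simp only [Literature.Geometry.Kaehler.MForm.ofChart, hx, if_true]
    have hcd : Literature.Geometry.Kaehler.MForm.chartDensity p α (extChartAt I p x) =
        LinearMap.det (tangentCoordChange I p x x : E →ₗ[ℝ] E) * α x (modelBasis E n) := by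
      simp only [Literature.Geometry.Kaehler.MForm.chartDensity, (extChartAt I p).map_source hx, if_true]
      rw [Literature.Geometry.Kaehler.MForm.inChart_apply_extChartAt α hx]
      exact ContinuousAlternatingMap.apply_comp_eq_det_mul (modelBasis E n) (α x)
        (tangentCoordChange I p x x) (modelBasis E n)
    rw [hR, ContinuousAlternatingMap.compContinuousLinearMap_eq_det_smul (modelBasis E n),
      smul_smul, hcd, ← mul_assoc, hdet, one_mul]
    exact ContinuousAlternatingMap.eq_apply_basis_smul (modelBasis E n) (α x) D hD
  · rw [hα x hx, Literature.Geometry.Kaehler.MForm.ofChart_apply_of_notMem p _ hx]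

/-- The chart density vanishes off any set `K` containing the chart images of the points where
`α` is nonzero (for `α` supported in the chart source). [folklore] -/
theorem _root_.Literature.Geometry.Kaehler.MForm.chartDensity_eq_zero (p : M) (α : Literature.Geometry.Kaehler.MForm I M ℝ n) {K : Set E}
    (hK : ∀ x, α x ≠ 0 → x ∈ (extChartAt I p).source ∧ extChartAt I p x ∈ K) {y : E}
    (hy : y ∉ K) : Literature.Geometry.Kaehler.MForm.chartDensity p α y = 0 := by
  unfold Literature.Geometry.Kaehler.MForm.chartDensity
  split_ifs with hyt
  · have : α ((extChartAt I p).symm y) = 0 := by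
      by_contra h
      obtain ⟨-, hk⟩ := hK _ h
      rw [(extChartAt I p).right_inv hyt] at hk
      exact hy hk
    rw [Literature.Geometry.Kaehler.MForm.inChart_apply, this]
    rfl
  · rfl

/-- The closed support of the chart density lies in any closed set `K` as in
`MForm.chartDensity_eq_zero`. [folklore] -/
theorem _root_.Literature.Geometry.Kaehler.MForm.tsupport_chartDensity_subset (p : M) (α : Literature.Geometry.Kaehler.MForm I M ℝ n) {K : Set E}
    (hKc : IsClosed K)
    (hK : ∀ x, α x ≠ 0 → x ∈ (extChartAt I p).source ∧ extChartAt I p x ∈ K) :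
    tsupport (Literature.Geometry.Kaehler.MForm.chartDensity p α) ⊆ K :=
  closure_minimal (fun _ hy ↦ by_contra fun h ↦ hy (Literature.Geometry.Kaehler.MForm.chartDensity_eq_zero p α hK h))
    hKc

/-- **The chart density of a smooth top form is smooth**, when the form is supported in the
preimage of a closed subset `K` of the chart target (smoothness of the representative on the
target, `IsSmoothForm.contDiffOn_inChart`, and vanishing off `K`). [folklore] -/
theorem _root_.Literature.Geometry.Kaehler.MForm.contDiff_chartDensity [IsManifold I ∞ M] [I.Boundaryless] (p : M) {α : Literature.Geometry.Kaehler.MForm I M ℝ n}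
    (hα : Literature.Geometry.Kaehler.IsSmoothForm α)
    {K : Set E} (hKc : IsClosed K) (hKt : K ⊆ (extChartAt I p).target)
    (hK : ∀ x, α x ≠ 0 → x ∈ (extChartAt I p).source ∧ extChartAt I p x ∈ K) :
    ContDiff ℝ ∞ (Literature.Geometry.Kaehler.MForm.chartDensity p α) := by
  refine contDiff_iff_contDiffAt.2 fun y ↦ ?_
  by_cases hy : y ∈ (extChartAt I p).target
  · have heq : Literature.Geometry.Kaehler.MForm.chartDensity p α =ᶠ[𝓝 y] fun y ↦ α.inChart p y (modelBasis E n) := by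
      filter_upwards [(isOpen_extChartAt_target p).mem_nhds hy] with y' hy'
      simp only [Literature.Geometry.Kaehler.MForm.chartDensity, hy', if_true]
    refine ContDiffAt.congr_of_eventuallyEq ?_ heq
    have h1 : ContDiffAt ℝ ∞ (α.inChart p) y :=
      (hα.contDiffOn_inChart p).contDiffAt ((isOpen_extChartAt_target p).mem_nhds hy)
    exact ContDiffAt.continuousAlternatingMap_apply_const h1 (modelBasis E n)
  · have hyK : y ∉ K := fun h ↦ hy (hKt h)
    have heq : Literature.Geometry.Kaehler.MForm.chartDensity p α =ᶠ[𝓝 y] fun _ ↦ 0 := by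
      filter_upwards [hKc.isOpen_compl.mem_nhds hyK] with y' hy'
      exact Literature.Geometry.Kaehler.MForm.chartDensity_eq_zero p α hK hy'
    exact contDiffAt_const.congr_of_eventuallyEq heq

variable [IsManifold I ∞ M] [MeasurableSpace E] [BorelSpace E] [T2Space M] [SigmaCompactSpace M]
  [CompactSpace M] [I.Boundaryless] (o : (x : M) → Orientation ℝ (TangentSpace I x) (Fin n))

/-- **Integral of a top form supported in a chart**: `∫_M α = ε ∫ chartDensity p α` when `α`
is smooth, supported in the preimage of a compact `K` in the chart target on which the chart
sign is the constant `ε`. Lee (2013), Prop. 16.4 / 16.5 (the defining formula of the integral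
for forms supported in one chart, independent of the partition of unity).
[cite: LeeSmoothManifolds2013, Prop. 16.5] -/
theorem _root_.Literature.Geometry.Kaehler.MForm.integral_eq_chartDensity (p : M) {D : E [⋀^Fin n]→L[ℝ] ℝ}
    (hD : D (modelBasis E n) = 1) {α : Literature.Geometry.Kaehler.MForm I M ℝ n} (hα : Literature.Geometry.Kaehler.IsSmoothForm α) {K : Set E}
    (hKc : IsCompact K) (hKt : K ⊆ (extChartAt I p).target)
    (hK : ∀ x, α x ≠ 0 → x ∈ (extChartAt I p).source ∧ extChartAt I p x ∈ K) {ε : ℝ}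
    (hε : ∀ y ∈ K, chartSign o p y = ε) :
    Literature.Geometry.Kaehler.MForm.integral o α = ε * ∫ y, Literature.Geometry.Kaehler.MForm.chartDensity p α y ∂(modelBasis E n).addHaar := by
  have hα0 : ∀ x ∉ (extChartAt I p).source, α x = 0 := fun x hx ↦ by
    by_contra h
    exact hx (hK x h).1
  have hts := Literature.Geometry.Kaehler.MForm.tsupport_chartDensity_subset p α hKc.isClosed hK
  conv_lhs => rw [Literature.Geometry.Kaehler.MForm.eq_ofChart_chartDensity_smul p hD hα0]
  exact Literature.Geometry.Kaehler.MForm.integral_ofChart_smul o p hD (Literature.Geometry.Kaehler.MForm.contDiff_chartDensity p hα hKc.isClosed hKt hK).continuous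
    (IsCompact.of_isClosed_subset hKc (isClosed_tsupport _) hts) (hts.trans hKt)
    fun y hy ↦ hε y (hts hy)

end Density

end Literature.NumberTheory.Transcendental
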